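import Mathlib
import Summits.KontsevichZagierPeriods.Zeta5Search.BrickTheoremSixS
import Summits.KontsevichZagierPeriods.Zeta5Search.BrickDigitSideZero
import Summits.KontsevichZagierPeriods.Zeta5Search.BrickOffDigitZero

/-!
# BrickTheoremSixZero — THEOREM 6 (S) for the CONSTANT-TERM CELL `s = 0`: `v_p(p^{2τ_0}x_0(np) − p^{τ_0}x_0(n)) ≥ 3`
for EVERY `n < p²` (`p ≥ 5`, `A` even, `A ≥ 5`, `2 ≤ 2B ≤ A`, `τ_0 = A − 1`) — a KERNEL THEOREM (cell zeta5-irr)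

HONEST FRAMING: systematic search; no irrationality claim unless certified. INSTRUMENT theorem of the ζ(5)
census cell zeta5-irr (HOME `run/shared/lean/pub/zeta5-irr/`; memo `zi-p2/probes/B8/thm6/THEOREM6.md` §1 THEOREM 6:
«`β_s(pn) ≡ β_s(n) mod p³` for `s ∈ {0} ∪ {1 ≤ s ≤ A−1 …}`», `β_0(m) = p^{(A−1)v_p(m)}x_0(m)`; with
`BrickTheoremSixS.theoremSix_S` (the cells `s ≥ 1`, zi-ref R6.22) this file completes the display (S) of THEOREM 6
in the kernel in its normalised β-free form). Nothing here is about ζ(5); no irrationality content; filing moves no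
rung (zi-p2's THEOREM 6 is a certified instrument-tier statement about the top-`p`-layer structure of the brick
linear forms, not about their size). Filed by the engine seat zi-eng (g8): assembly of
`BrickDigitSideZero.sum_digitDZero_le` (digit side: Steps (D2), (E1⁺)₀, (F5)₀, LEMMA Φ4, Wolstenholme) and
`BrickOffDigitZero.offDigitZero_term_le` (Step G⁺: each off-digit term has valuation `≥ A − 2 ≥ 3`).

## The statement

For a prime `p ≥ 5`, `A` even with `A ≥ 5`, `1 ≤ B`, `2B ≤ A`, and every `n < p²`, with
`xZero A B 1 m = Σ_{K=0}^{m} cellZero A B 1 m K` (`BrickPartialFractions`: the constant term `x_0(m)` of the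
partial-fraction decomposition of the brick `R_m(t) = (t + m/2)·(t−m)_m^A/(t)_{m+1}^A·((t+1)_m(−t+m+1)_m/(t)_{m+1}^2)^B`
summed over `t`) and `τ_0 = A − 1`:

**`v(p^{2τ_0}·xZero A B 1 (np) − p^{τ_0}·xZero A B 1 n) ≤ exp(−3)`** (`theoremSix_Z`).
-/

namespace Summit.KontsevichZagierPeriods.Zeta5Search.BrickTheoremSixZero

open Finset Nat WithZero
open Summit.KontsevichZagierPeriods.Zeta5Search.BrickPartialFractions (cellZero xZero)
open Summit.KontsevichZagierPeriods.Zeta5Search.BrickDigitStepDZero (digitDZero)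
open Summit.KontsevichZagierPeriods.Zeta5Search.BrickDigitSideZero (sum_digitDZero_le)
open Summit.KontsevichZagierPeriods.Zeta5Search.BrickOffDigitZero (offDigitZero_term_le)
open Summit.KontsevichZagierPeriods.Zeta5Search.BrickTheoremSixS (sum_filter_dvd_eq)

noncomputable section

variable {p : ℕ} [Fact p.Prime]

/-- **THEOREM 6 (S), the harmonic cell `s = 0`**: `v_p(p^{2τ_0}·x_0(np) − p^{τ_0}·x_0(n)) ≥ 3`, `τ_0 = A − 1`. -/
theorem theoremSix_Z (h3 : 3 < p) {A B n : ℕ} (hA : Even A) (hA5 : 5 ≤ A) (hAB : 2 * B ≤ A) (hB : 1 ≤ B)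
    (hn : n < p ^ 2) :
    Rat.padicValuation p ((p : ℚ) ^ (2 * (A - 1)) * xZero A B 1 (n * p) -
      (p : ℚ) ^ (A - 1) * xZero A B 1 n) ≤ exp (-3) := by
  have hp : p.Prime := Fact.out
  have hp2 : p ≠ 2 := by omega
  set τ := A - 1 with hτ
  -- split the level-`np` sum into digits and off-digits
  have hsplit : (p : ℚ) ^ (2 * τ) * xZero A B 1 (n * p) - (p : ℚ) ^ τ * xZero A B 1 n =
      ∑ j ∈ range (n + 1), digitDZero A B p 1 n j +
        ∑ K ∈ (range (n * p + 1)).filter (fun K => ¬ p ∣ K), (p : ℚ) ^ (2 * τ) * cellZero A B 1 (n * p) K := by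
    unfold xZero
    rw [Finset.mul_sum, Finset.mul_sum, ← sum_filter_add_sum_filter_not (range (n * p + 1)) (fun K => p ∣ K),
      sum_filter_dvd_eq, add_sub_right_comm, ← Finset.sum_sub_distrib]
    congr 1
    refine Finset.sum_congr rfl fun j _ => ?_
    rw [digitDZero, hτ, one_mul, two_mul, pow_add]
    ring
  rw [hsplit]
  refine (Valuation.map_add _ _ _).trans (max_le (sum_digitDZero_le h3 hA hAB hB hn) ?_)
  refine Valuation.map_sum_le _ fun K hK => ?_
  have hndvd := (mem_filter.1 hK).2
  have hKlt : K < n * p := by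
    rcases Nat.lt_or_ge K (n * p) with h | h
    · exact h
    · exfalso; exact hndvd ⟨n, by have := mem_range.1 (mem_filter.1 hK).1; rw [mul_comm]; omega⟩
  have hjn : K / p < n := (Nat.div_lt_iff_lt_mul hp.pos).2 hKlt
  have hi1 : 1 ≤ K % p := by
    by_contra h
    exact hndvd (Nat.dvd_of_mod_eq_zero (by omega))
  have hip : K % p < p := Nat.mod_lt _ hp.pos
  have h := offDigitZero_term_le (p := p) hp2 hAB (by omega) hn hjn hi1 hip
  rw [Nat.div_add_mod'] at h
  exact h.trans (exp_le_exp.2 (by omega))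

/-- **THEOREM 6 (S), all cells, one display**: for `p ≥ 5`, `A` even, `A ≥ 5`, `1 ≤ B`, `2B ≤ A`, `n < p²`:
the harmonic cell (`theoremSix_Z`) and every cell `1 ≤ s ≤ A − 1` (`BrickTheoremSixS.theoremSix_S`). -/
theorem theoremSix (h3 : 3 < p) {A B n : ℕ} (hA : Even A) (hA5 : 5 ≤ A) (hAB : 2 * B ≤ A) (hB : 1 ≤ B)
    (hn : n < p ^ 2) :
    Rat.padicValuation p ((p : ℚ) ^ (2 * (A - 1)) * xZero A B 1 (n * p) -
        (p : ℚ) ^ (A - 1) * xZero A B 1 n) ≤ exp (-3) ∧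
      ∀ s, s + 1 ≤ A → Rat.padicValuation p
        ((p : ℚ) ^ (2 * (A - 1 - s)) * BrickPartialFractions.xCoeff A B 1 (n * p) s -
          (p : ℚ) ^ (A - 1 - s) * BrickPartialFractions.xCoeff A B 1 n s) ≤ exp (-3) :=
  ⟨theoremSix_Z h3 hA hA5 hAB hB hn, fun _ hs => BrickTheoremSixS.theoremSix_S h3 hA hA5 hAB hB hn hs⟩

end

end Summit.KontsevichZagierPeriods.Zeta5Search.BrickTheoremSixZero
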